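import Summits.Langlands.Langlands.Theses.MirrorPairReflection

/-!
# BC3 birth skeleton — child `WeakExistence` of the BC2-redirect split of `MirrorPairReflection.SectorComplement`
(crux stmt-Langlands-12840; crux-strategist `cstrat-stmt-Langlands-12840-r1`, 2026-08-17)

`WeakExistence` (W — Buzzard–Gee Conj. 3.2.2, weak form; VERBATIM the text of the registered stub `stub_weakExistence`
of the lines birth_MirrorPairReflection / birth (14623) / Sketch (14328) and of the proposed child `CapacityClassicality.WeakExistence`
of the homonymous split on stmt-Langlands-10368): cut, as there, into the SEMISIMPLE AVATAR (Shimura-variety / congruence output)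
and DE RHAM OF AUTOMORPHIC (p-adic Hodge theory of the avatar).  Stub texts VERBATIM those of
`Cruxes/SectorToLanglands/Lines/birth_WeakExistence.lean` (shared staffing).

Shape: ≥ 2 NAMED stubs `stub_*` (the ONLY sorries of this file) and the kernel-checked composition
`WeakExistence_of : <stub₁-sig> → <stub₂-sig> → WeakExistence` (+ `WeakExistence_of_stubs`).  Context = the route file's
(the child is restated here VERBATIM from children.json; after `route edit --split` it is the route's own decl
`Summit.Langlands.Langlands.Theses.MirrorPairReflection.WeakExistence` and this local copy is deleted — post-split
version `post/birth_WeakExistence.lean` in the planner folder).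
-/

noncomputable section

set_option linter.dupNamespace false

namespace Summit.Langlands.Langlands.Theses.MirrorPairReflection

open scoped BigOperators Topology Manifold Classical MeasureTheory ProbabilityTheory Matrix InnerProductSpace ComplexConjugate ContinuousMap
open Filter Set Function TopologicalSpace MeasureTheory

/-- child `WeakExistence` (children.json statement VERBATIM). -/
def WeakExistence : Prop :=
  ∀ (K : Type) [Field K] [NumberField K] (n : ℕ) (hcpt : Literature.NumberTheory.Automorphic.isCompact_glFiniteIntegralLevel n K), 0 < n → ∀ π : Literature.NumberTheory.Automorphic.CuspidalAutomorphicRepData n K hcpt, π.1.IsLAlgebraic → ∀ (ℓ : ℕ) [Fact ℓ.Prime] (ι : PadicAlgCl ℓ ≃+* ℂ), ∃ ρ : Literature.NumberTheory.GaloisRepresentations.FramedGaloisRep K (PadicAlgCl ℓ) n, ((∀ᶠ v : IsDedekindDomain.HeightOneSpectrum (NumberField.RingOfIntegers K) in cofinite, ρ.IsUnramifiedAt v) ∧ ∀ (v : IsDedekindDomain.HeightOneSpectrum (NumberField.RingOfIntegers K)) (hv : ((ℓ : ℕ) : NumberField.RingOfIntegers K) ∈ v.asIdeal), (Literature.NumberTheory.PAdicHodge.fontainePstAdicCompletion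 v ℓ hv).IsDeRhamFramed (ρ.toLocal v)) ∧ ∀ᶠ v : IsDedekindDomain.HeightOneSpectrum (NumberField.RingOfIntegers K) in cofinite, SatakeFrobCompatibleAt ι π.1 ρ v

namespace Cruxes.WeakExistence.Birth

/-- **stub W₁ (OPEN: existence of a semisimple compatible-system member)**: every L-algebraic cuspidal `π` of
`GL_n(𝔸_K)` has, for all `ℓ, ι`, SOME semisimple `ρ : Γ_K → GL_n(ℚ̄_ℓ)` unramified a.e. and Satake–Frobenius compatible
with `π` a.e. — NO `p`-adic Hodge clause (HLTT 2016 Thm A + Scholze 2015 V.4.2 for regular algebraic `π` over CM / totally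
real `K`; open otherwise: NonRegularWeightBarrier, ShimuraVarietyRealizationBarrier).
[cite: BuzzardGeeLMS2014, Conj. 3.2.2] [cite: HarrisLanTaylorThorneRMS2016, Thm. A] -/
theorem stub_semisimpleAvatar :
    ∀ (K : Type) [Field K] [NumberField K] (n : ℕ) (hcpt : Literature.NumberTheory.Automorphic.isCompact_glFiniteIntegralLevel n K), 0 < n → ∀ π : Literature.NumberTheory.Automorphic.CuspidalAutomorphicRepData n K hcpt, π.1.IsLAlgebraic → ∀ (ℓ : ℕ) [Fact ℓ.Prime] (ι : PadicAlgCl ℓ ≃+* ℂ), ∃ ρ : Literature.NumberTheory.GaloisRepresentations.FramedGaloisRep K (PadicAlgCl ℓ) n, ρ.toGaloisRep.IsSemisimple ∧ (∀ᶠ v : IsDedekindDomain.HeightOneSpectrum (NumberField.RingOfIntegers K) in cofinite, ρ.IsUnramifiedAt v) ∧ ∀ᶠ v : IsDedekindDomain.HeightOneSpectrum (NumberField.RingOfIntegers K) in cofinite, SatakeFrobCompatibleAt ι π.1 ρ v := by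
  sorry

/-- **stub W₂ (OPEN: automorphic Galois representations are de Rham)**: every SEMISIMPLE `ρ` unramified a.e. and
Satake–Frobenius compatible a.e. with an L-algebraic cuspidal `π` is de Rham at every `v ∣ ℓ` for Fontaine's pinned datum
(regular algebraic over CM: A'Campo 2024 / Caraiani–Newton 2023 in the crystalline range; a consequence of the summit by
Chebotarev–Brauer–Nesbitt rigidity + frame invariance of `IsDeRhamFramed`).
[cite: FontaineMazurGeometric1995, §1] [cite: BuzzardGeeLMS2014, Conj. 3.2.2] -/
theorem stub_deRhamOfAutomorphic :
    ∀ (K : Type) [Field K] [NumberField K] (n : ℕ) (hcpt : Literature.NumberTheory.Automorphic.isCompact_glFiniteIntegralLevel n K), 0 < n → ∀ π : Literature.NumberTheory.Automorphic.CuspidalAutomorphicRepData n K hcpt, π.1.IsLAlgebraic → ∀ (ℓ : ℕ) [Fact ℓ.Prime] (ι : PadicAlgCl ℓ ≃+* ℂ) (ρ : Literature.NumberTheory.GaloisRepresentations.FramedGaloisRep K (PadicAlgCl ℓ) n), ρ.toGaloisRep.IsSemisimple → (∀ᶠ v : IsDedekindDomain.HeightOneSpectrum (NumberField.RingOfIntegers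 K) in cofinite, ρ.IsUnramifiedAt v) → (∀ᶠ v : IsDedekindDomain.HeightOneSpectrum (NumberField.RingOfIntegers K) in cofinite, SatakeFrobCompatibleAt ι π.1 ρ v) → ∀ (v : IsDedekindDomain.HeightOneSpectrum (NumberField.RingOfIntegers K)) (hv : ((ℓ : ℕ) : NumberField.RingOfIntegers K) ∈ v.asIdeal), (Literature.NumberTheory.PAdicHodge.fontainePstAdicCompletion v ℓ hv).IsDeRhamFramed (ρ.toLocal v) := by
  sorry

/-- **W from its two stubs**: take the semisimple avatar of W₁; it is de Rham above `ℓ` by W₂. -/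
theorem WeakExistence_of :
    (∀ (K : Type) [Field K] [NumberField K] (n : ℕ) (hcpt : Literature.NumberTheory.Automorphic.isCompact_glFiniteIntegralLevel n K), 0 < n → ∀ π : Literature.NumberTheory.Automorphic.CuspidalAutomorphicRepData n K hcpt, π.1.IsLAlgebraic → ∀ (ℓ : ℕ) [Fact ℓ.Prime] (ι : PadicAlgCl ℓ ≃+* ℂ), ∃ ρ : Literature.NumberTheory.GaloisRepresentations.FramedGaloisRep K (PadicAlgCl ℓ) n, ρ.toGaloisRep.IsSemisimple ∧ (∀ᶠ v : IsDedekindDomain.HeightOneSpectrum (NumberField.RingOfIntegers K) in cofinite, ρ.IsUnramifiedAt v) ∧ ∀ᶠ v : IsDedekindDomain.HeightOneSpectrum (NumberField.RingOfIntegers K) in cofinite, SatakeFrobCompatibleAt ι π.1 ρ v) →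
    (∀ (K : Type) [Field K] [NumberField K] (n : ℕ) (hcpt : Literature.NumberTheory.Automorphic.isCompact_glFiniteIntegralLevel n K), 0 < n → ∀ π : Literature.NumberTheory.Automorphic.CuspidalAutomorphicRepData n K hcpt, π.1.IsLAlgebraic → ∀ (ℓ : ℕ) [Fact ℓ.Prime] (ι : PadicAlgCl ℓ ≃+* ℂ) (ρ : Literature.NumberTheory.GaloisRepresentations.FramedGaloisRep K (PadicAlgCl ℓ) n), ρ.toGaloisRep.IsSemisimple → (∀ᶠ v : IsDedekindDomain.HeightOneSpectrum (NumberField.RingOfIntegers K) in cofinite, ρ.IsUnramifiedAt v) → (∀ᶠ v : IsDedekindDomain.HeightOneSpectrum (NumberField.RingOfIntegers K) in cofinite, SatakeFrobCompatibleAt ι π.1 ρ v) → ∀ (v : IsDedekindDomain.HeightOneSpectrum (NumberField.RingOfIntegers K)) (hv : ((ℓ : ℕ) : NumberField.RingOfIntegers K) ∈ v.asIdeal), (Literature.NumberTheory.PAdicHodge.fontainePstAdicCompletion v ℓ hv).IsDeRhamFramed (ρ.toLocal v)) →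
    WeakExistence := by
  intro h1 h2 K _ _ n hcpt hn π hπ ℓ _ ι
  obtain ⟨ρ, hss, hur, hρ⟩ := h1 K n hcpt hn π hπ ℓ ι
  exact ⟨ρ, ⟨hur, fun v hv => h2 K n hcpt hn π hπ ℓ ι ρ hss hur hρ v hv⟩, hρ⟩

/-- The composition with the stubs plugged in. -/
theorem WeakExistence_of_stubs : WeakExistence :=
  WeakExistence_of stub_semisimpleAvatar stub_deRhamOfAutomorphic

end Cruxes.WeakExistence.Birth

end Summit.Langlands.Langlands.Theses.MirrorPairReflection

end
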